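import Mathlib
import HarnessLib
import HarnessLib.Audit
import Summits.BirchSwinnertonDyer.Statement
import Summits.BirchSwinnertonDyer.BirchSwinnertonDyer.Theorems.SchneiderWeakenLeaf
import HarnessLib.Audit.Status.Attr

/-!
Route: SlopeDichotomyA2

# Route SlopeDichotomyA2 — Critical-slope exit for the p-part of BSD on A2's degenerate-height locus

It suffices to show `DegenerateLocusA2`: for every globally minimal `E/ℚ` and odd good ordinary
prime `p` with `(E,p)` on corner A2
(rank-one X1 type B: `r_an(E) = 1`, `E[p]` reducible with Greenberg–Vatsal parity — `X1.TypeBRankOne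
W p`, 1 307 census cells,
2 797 class-pairs `N < 5·10⁵`) at which THE canonical cyclotomic `p`-adic height DEGENERATES
(`DegenerateAt W p`: some canonical
`PAdicHeightData` violates `SchneiderConjecture`), the `p`-part of BSD `BSDp W p` holds. On the
complementary (non-degenerate) pairs
the kernel theorem `X1.bsdp_of_typeBRankOne_of_schneider` (the α-road: Greenberg–Vatsal +
Schneider/BMS + Perrin-Riou + Mazur–Tate σ
+ GZK) already yields `BSDp` from the six landed facts `PublishedInputsA2`; excluded middle on the
Schneider rider then gives the rung
leaf `TypeBRankOneUnridered` (= README row A2 with the binder `hSch` deleted; D-0061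
`closes_target`). The line's content is that the
degenerate locus is exactly where the CRITICAL-SLOPE (β) road has teeth: in rank one `h_α(P,P) −
h_β(P,P) = c·log_ω(P)²` with
`c ≠ 0`, so degeneracy of `h_α` forces `h_β(P,P) ≠ 0` (proved over the posited interface
`CriticalSlopeHeightData` in the memo sketch `SchneiderWeakenSockets.lean`, not landed:
`beta_ne_zero_of_degenerateAt`), and the
β-leading-term formula + β-main-conjecture/β-Gross–Zagier are to give the `p`-part there.
CONDITIONAL BRIDGE on the NAMED TREE
CONJECTURE
`Summit.BirchSwinnertonDyer.BirchSwinnertonDyer.Theorems.SchneiderWeaken.DegenerateLocusA2`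
(`@[conjecture]`, landed in
`Theorems/SchneiderWeakenLeaf.lean`, p406724; the same text as this route's one crux — the gate
requires an ACCEPTED declaration as the
condition), whose intended proof is the β-road: Büyükboduk–Pollack–Sasaki (arXiv:1811.08216) Cor.
1.1.2 / Thm. 1.1.6 WITHOUT their
absolute-irreducibility hypothesis (BuyukbodukPollackSasaki2018 ⊖ (irr)).
Lean: `∀ (W : WeierstrassCurve ℚ) [W.IsElliptic] [W.IsGloballyMinimal] (p : ℕ) [Fact p.Prime],
Summit.BirchSwinnertonDyer.Rank1Residual.X1.TypeBRankOne W p → (∃ Dh :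
WeierstrassCurve.PAdicHeightData W p, Dh.IsCanonical ∧ ¬ WeierstrassCurve.SchneiderConjecture Dh) →
Literature.NumberTheory.EllipticCurves.BSDp W p`

## Assembly
Pure logic, kernel-checked (`glue.lean` = `closes`, render-simulated in `RenderSim.lean`, lean check
rc 0 / 0 sorries): fix an A2 pair
`(W,p)`; `by_cases` on the rider «every canonical `PAdicHeightData W p` satisfies
`SchneiderConjecture`»; if yes, destructure
`PublishedInputsA2` into the six facts and apply
`Summit.BirchSwinnertonDyer.Rank1Residual.X1.bsdp_of_typeBRankOne_of_schneider`
(tree, sorry-free) to get `BSDp W p`; if no, `push Not` produces a degenerate canonical datum, i.e.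
`DegenerateAt W p`, and
`DegenerateLocusA2` gives `BSDp W p`. Conclusion = the leaf `TypeBRankOneUnridered` (closed
`@[conjecture] def` in the landed `Theorems/SchneiderWeakenLeaf.lean`, p406724 ACCEPTED
76789772741a; D-0061 `--closes-target`).
The Assembly item below (schema: exactly one at open) is the statement of `closes` itself
(`assembly_holds : Assembly := closes` in RenderSim, so it is settled by the glue, not staffed);
every other declared item is a binder of `closes` (BC6: declared 3 = 2 binders + the assembly node).

CLOSES_TARGET: closes rung I1 of BirchSwinnertonDyer: Summit.BirchSwinnertonDyer.BirchSwinnertonDyer.Theorems.SchneiderWeaken.TypeBRankOneUnridered (D-0061; not the summit Statement) — the deciding theorem of this route concludes that registered leaf instead of the Statement decl `BirchSwinnertonDyer` (class rung: servable and labelled, never counted as concluding the summit Statement).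

CONDITIONAL on Summit.BirchSwinnertonDyer.BirchSwinnertonDyer.Theorems.SchneiderWeaken.DegenerateLocusA2 — this route is an explicit reduction to that named conjecture (D-0019: crux floor waived).

Rationale: WHY THIS LINE. Mechanism: the slope dichotomy of cyclotomic `p`-adic heights. For good ordinary `p`
the two Frobenius eigen-splittings of
`D_cris(V_pE)` give heights `h_α` (unit root = Mazur–Tate/Schneider, the kernel's) and `h_β`
(critical slope), and
`h_α − h_β = c·log_ω ⊗ log_ω` with `c ≠ 0` (Perrin-Riou, `PerrinRiou1993AIF` §3.3.7 Rem. ii; BPS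
arXiv:1811.08216 §6.2); in rank one at
most ONE of them can vanish on the generator (pair lemma = the barrier file's own
`ne_zero_or_ne_zero_of_sub_eq_mul_sq`; kit j244598
confirms the identity with `B = −log_ω(P)²` exactly and `c ≠ 0` on all 2 797 A2 class-pairs, both
heights non-degenerate everywhere). BPS Thm. 1.1.6 / Cor. 1.1.2 prove «`h_α` OR `h_β` non-degenerate
⇒ `p`-part of the BSD
formula» for supersingular and for ordinary ABSOLUTELY IRREDUCIBLE `ρ̄` (p. 4 L38, p. 5 L41),
through a two-variable `p`-adic `L`-function
in a Coleman family and a `p`-adic Gross–Zagier formula at critical slope (Kobayashi, in progress,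
p. 17 L15); corner A2 is reducible and
anomalous, exactly outside their hypothesis, while its α-road is kernel-complete modulo Schneider.
Imported: critical-slope `p`-adic
`L`-functions (`PollackStevens2011`, `Bellaiche2011`, Loeffler–Zerbes arXiv:1012.0175),
Perrin-Riou's `D_cris`-valued leading-term
formalism (`PerrinRiou1993AIF` Prop. 3.4.6), Nekovář heights of splittings (`Nekovar1993`). What it
does that prior routes and the
negatives index do not: every existing BSD route either carries the Schneider rider on the
cyclotomic road (PAdicOrder, PAdicOrderV2,
LeadingTerm, KatoTransfer) or leaves the road (P2's anticyclotomic door); none uses the SECOND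
height as an exit on the locus where the
first one dies, and the one refuted statement of the summit (LeadingTermTamePinch, an `∃ p ≥ 5`
ordinary-prime claim) is not touched.

RANKED CRUXES. #2 DegenerateLocusA2 (crux) — the `p`-part of BSD on the degenerate locus of corner
A2 — for every globally minimal `E/ℚ`, odd prime `p` with `X1.TypeBRankOne W p` (good ordinary
anomalous, `E[p]` reducible with GV parity, `r_an = 1`) and a canonical `p`-adic height datum
violating Schneider's conjecture, `BSDp W p`. It is the leaf MINUS the α-road: modulo
`PublishedInputsA2` it is EQUIVALENT to the leaf
(`SchneiderWeaken.leaf_iff_degenerateLocus_of_inputs`, proved in the landed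
`Theorems/SchneiderWeakenLeaf.lean`, p406724) — declared, not hidden: this is a conditional bridge /
redirect whose open half is this decl and whose closed half is the kernel theorem by name.
[difficulty: open-problem] (why it might fail: the β-road's p-adic Gross–Zagier (BPS Cor. 1.1.2) is
proved only for absolutely irreducible ρ̄ and rests on Kobayashi's unpublished critical-slope GZ; at
reducible anomalous p the integral β-main conjecture for the GV lattice may be false (μ/λ shift
along the p-isogeny).) [BuyukbodukPollackSasaki2018, arXiv:1811.08216, PerrinRiou1993AIF,
arXiv:1012.0175, arXiv:2409.01350, GreenbergVatsal2000]
#9 PublishedInputsA2 (support) — the six PUBLISHED inputs of the kernel's A2 theorem as one closed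
conjunction of named Literature facts (each `def … : Prop`, cite-tagged, unproved in the tree, used
BY NAME): Greenberg–Vatsal 2000 Thm. (1.3) for the GV-parity lattice at odd `p`; Schneider 1985 /
Balakrishnan–Müller–Stein 2015 Thm. 1.7 (order and leading coefficient of the characteristic series,
odd `p`); Perrin-Riou 1987 §1.4 (rank-one leading terms, odd `p`); Mazur–Stein–Tate 2006 Thm. 1.3 (a
Mazur–Tate σ / canonical datum exists at odd `p`); modularity (a modular parametrisation exists);
Gross–Zagier–Kolyvagin (rank = analytic rank ≤ 1). A prover closes it only by landing the facts; the
route needs it as the hypothesis list of the α-road. [difficulty: open-problem]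
[GreenbergVatsal2000, Schneider1985, BalakrishnanMullerStein2015, PerrinRiou1987,
MazurSteinTate2006]

TWO-LAYER PLAN. `DegenerateLocusA2 ⇐ ClassicalClausesA2 → PPartOnDegenerateLocusA2 →
DegenerateLocusA2` (the registered birth skeleton
`bc/DegenerateLocusA2_birth_leaf.lean`, typed against the LANDED leaf statements, composition
`DegenerateLocusA2_of` sorry-free; published as `Cruxes/DegenerateLocusA2/Lines/birth.lean` at
open): the classical clauses (rank = 1 = r_an, `Ш[p^∞]`
finite, `Ш_an ∈ ℚ`) are GZK + Cassels bookkeeping over landed facts; the `p`-part on the degenerate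
locus is the β-road proper, to be
split further ONLY when its objects are typed (definition requests D1–D3): `PPart ⇐
BetaLeadingTermA2 → BetaMainConjectureA2 →
BetaGrossZagierA2 → PPart`, filed at open as INFORMAL ranked cruxes (rank 3 `BetaGrossZagierA2`,
rank 4 `BetaLeadingTermA2`, rank 5
`SlopeGapReducible`, rank 6 `BetaMainConjectureA2`) with `ledger workitem add --informal`.

KILL CRITERIA. `DegenerateLocusA2` is a consequence of BSD, so a refutation of it (an A2 pair with a
degenerate canonical height and `BSDp` false)
refutes BSD itself — the route then closes `refuted:DegenerateLocusA2` together with the summit's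
rank-one corner. The LINE (not the
statement) dies if (i) the slope gap `c` vanishes or the identity `h_α − h_β = c·log_ω²` fails at
some reducible anomalous pair (kit
j244598 found `c ≠ 0` and the identity exact on all 2 797 A2 class-pairs; a failure beyond the
census would leave the β-exit toothless there and the route retires `exhausted` with the census), or
(ii) the
β-`p`-adic Gross–Zagier formula is shown false/unprovable at Eisenstein primes (pivot to memo
ROUTE-P3 (M2) central-critical road or
to P2's anticyclotomic door). Mooted if Schneider's conjecture is PROVED on A2 (`DegenerateAt` empty
⇒ crux vacuous ⇒ leaf = kernel
theorem; director's I1 leaf `Schneider1985_charGenerator_rankOne`), or if the b2b lane lands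
`BSDpOnClassX1` (`leaf_of_bsdpOnClassX1`).

NOT DECOMPOSED YET. The β-road itself (β-leading-term formula `L′_{p,β}(0) ≐
(1−1/β)²·h_β(P,P)·#Ш·Tam/#E_tors²` with Perrin-Riou's `D_cris` normalisation;
the β-main conjecture for the GV lattice via Kato; β-Gross–Zagier in a Coleman family through the
critical-slope refinement at an
Eisenstein point; the gap constant `c = [ω,η_β−η_α]`-type unit) — none of its objects exists in the
tree (`padicLFunction f β` is a
junk `limUnder` for non-unit `β`; no `D_cris`, no height of a splitting), so these stay informal
cruxes + definition requests until
D1–D3 land; typing them over a hypothesis-structure was tried and is a costume (any `∃`-statement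
over `CriticalSlopeHeightData` is
reverse-engineerable from `BSDp`). Also not decomposed: `p = 3` vs `p ≥ 5` (same β-objects), the
`Ш`-trivial sub-locus.

CHEAPEST FALSIFIER. The slope-gap identity and BOTH height valuations on every A2 class-pair — RUN:
kit j244598 (PARI 2.15.4, Cremona generators; ALL 2 797 rank-one type-B class-pairs `N < 5·10⁵` =
2 444 @3 + 292 @5 + 53 @7 + 8 @13 from x1a GEN17 `ROUTE-R-R1-p*.tsv`; cpu 5 s; table
`kit/SLOPEGAP-CENSUS.md`, rows
`kit/slopegap-j244598.txt` sha256 ed5861d5…). Result: the η-coefficient of the `D`-valued height is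
`B = −log_ω(P)²` EXACTLY (ratio
`≡ −1 mod p³` on 2 797/2 797), hence `h_α − h_β = c·log_ω(P)²` with `v_p(c) ∈ {−2,…,−7}` finite on
every pair (`c ≠ 0`; memo flag m1
closed numerically, convention `h_ν = A − s_ν·B` self-calibrated against PARI's canonical regulator,
0 MISMATCH); `v_p(h_α)` finite on
2 797/2 797 (Schneider per pair, known) AND `v_p(h_β)` finite on 2 797/2 797 (new); 0 pairs with
both heights degenerate; halting
precision `v(h_α−h_β)+1 ≤ 14`. The falsifier did NOT fire. Still cheap and lethal: a counterexample
in print to β-`p`-adic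
Gross–Zagier at an Eisenstein prime (lookups: BPS §6, BSTW arXiv:2409.01350 §9).

NUMBERS. Corner A2 = 1 307 census cells ‖ 2 797 rank-one type-B class-pairs `N < 5·10⁵` (2 444 @3,
292 @5, 53 @7, 8 @13; x1a GEN17). The
α-certificate (`h_α ≠ 0`, i.e. Schneider per pair) is on file for every lane cell (README rows
A2/C1) and kit j244598 re-confirms it
(`v_p(h_α) ∈ [−1,7]`) and adds `v_p(h_β) ∈ [−5,9]` finite on all 2 797 — so `DegenerateAt` is EMPTY
on the whole census range and the
crux has no finite witness there by design. Distribution @3: `v(h_α) = 0` on 1 471, `v(h_β) = 1` on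
1 158; `h_β` more divisible than
`h_α` on 1 210, equal 681, less 553. Halting precision of the per-pair two-ball test (memo W28):
`v_p(h_α − h_β) + 1 = v_p(c) +
2·v_p(log_ω P) + 1 ≤ 14` digits (mode 1); by kit j245214, `v_p(c) = −v_p(F₂₁)` (η-coordinate of
φ(ω)), so the halting precision is known from Frobenius and the logarithm before any height is
computed. BPS's published regime: `p > 2` supersingular, or ordinary with `ρ̄` absolutely
irreducible
(arXiv:1811.08216 p. 4 L38); A2 ∩ that regime = ∅.

DEFINITION REQUESTS. - ONE slim statements+logic tree file, READY (lean check rc 0 / 0 err / 0 warn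
/ 0 sorries, 159 lines; audit: 2 conjecture nodes, 0 vendored-fact):
`Summits/BirchSwinnertonDyer/BirchSwinnertonDyer/Theorems/SchneiderWeakenLeaf.lean` (namespace
`Summit.BirchSwinnertonDyer.BirchSwinnertonDyer.Theorems.SchneiderWeaken`; copy in
`pub/bsd-schneider-ideate/memos/route-P3-D0059/`): the RUNG LEAF `TypeBRankOneUnridered`
(`@[conjecture]`, closed; D-0061 `--closes-target`), the crux `DegenerateLocusA2` (`@[conjecture]`,
same text as the route item), and the proved logic `leaf_of_rider` / `leaf_of_degenerateLocus` /
`degenerateLocus_of_leaf` / `leaf_iff_degenerateLocus_of_inputs` / `leaf_of_bsdpOnClassX1` /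
`not_degenerate_of_hasCM`. The fuller `SchneiderWeakenSockets.lean` (371 lines, rc 0: +
`DegenerateAt`, `PublishedInputsA2`, the posited interface `CriticalSlopeHeightData` with
`schneider_or_beta_ne_zero` / `beta_ne_zero_of_degenerateAt` / `bsdp_of_slopeDichotomy`, and the
halting certificate kernel `ballCert_or_ballCert_of_gap` / `ballTest_decides` / `bsdp_of_ballTest`)
stays in the memo folder as the β-road's typed sketch (referee-audited logic of ROUTE-P3-Sketch v4
§2/§2b) until D1–D3 give it real objects.
- D1 `CriticalSlopePAdicLFunction` (notion): the slope-one `p`-adic `L`-function `L_p(f,β,T)` of a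
weight-2 newform at a good ordinary prime (Pollack–Stevens overconvergent symbols
`PollackStevens2011` / JLMS 2013 doi:10.1112/jlms/jds057; `Bellaiche2011`; Lei–Loeffler–Zerbes
Wach-module construction arXiv:1012.0175 (Crelle 2012)) with its interpolation + growth
characterisation — replaces the junk `padicLFunction f (p/unitRoot)`.
- D2 `SplittingPAdicHeight` (notion): Nekovář's / Perrin-Riou's cyclotomic height attached to a
splitting of the Hodge filtration of `D_cris(V_pE)` (`Nekovar1993` §§2–7, `PerrinRiou1993AIF` §3.3),
specialising to the tree's `PAdicHeightData` at the unit-root splitting, with the comparison `h_α −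
h_β = c·log_ω ⊗ log_ω`.
- D3 `slopeGapConstant` (definition over D2): the constant `c(E,p,ω)` with the theorem `c ≠ 0` (`α ≠
β`); kit j244598 pins `v_p(c)` numerically per pair in PARI's `(ω, η = xω)` basis and kit j245214
confirms the CLOSED FORM `c = (α−β)/F₂₁` (`F` = PARI `ellpadicfrobenius`, so `v_p(c) = −v_p(F₂₁)`)
on 2 797/2 797 pairs (memo flag m1 closed).
- Cite facts wanted (hypotheses for the informal cruxes): Perrin-Riou 1993 Prop. 3.4.6 (leading term
of the `D_cris`-valued `L`-function, direction `D_[0]`); Loeffler–Zerbes 2013 (equality of the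
Wach-module and overconvergent critical-slope `L_p`); BPS 2018 Thm. 1.1.6 stays a CRUX input (its
(irr) hypothesis fails on A2), never a fact.

Novelty: Searches (2026-08-25): lit search --hybrid «critical slope p-adic height Gross-Zagier ordinary
reducible» (10 docs: arXiv:1811.08216, arXiv:2409.01350, Kobayashi 2013, Perrin-Riou 1993; none at
reducible p); lit search «Büyükboduk Pollack Sasaki p-adic Gross-Zagier critical slope» (8 docs);
lit galaxy search --star all «critical slope p-adic L-function|p-adic height critical slope|Coleman
family Heegner» (6 rows: [galaxy:pdf:-7972659087883370800] Pollack–Stevens, BPS, Loeffler–Zerbes; 0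
at Eisenstein primes); lit search «arXiv:1012.0175» (zbMATH: Crelle 679 (2013) 181–206); lean search
'DegenerateLocus|TypeBRankOne|CriticalSlope' (tree: only `X1.ClassClosureN1`, no critical-slope
object); ledger negatives --problem BirchSwinnertonDyer (1 unrelated entry); OpenAlex/S2 HTTP 429
today. g6 (20:46Z): lit search «critical slope p-adic Gross-Zagier Eisenstein reducible» + held-text
reads — the ANTICYCLOTOMIC road to the p-part of BSD in r_an ≤ 1 at Eisenstein primes
(Castella–Grossi–Lee–Skinner arXiv:2008.02571 Thm F = Thm 55 p.25; Castella–Grossi–Skinner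
arXiv:2303.04373 Thm 1 p.3 L44 / Thm 4 p.5) requires φ|G_p ≠ 1, ω, i.e. p NON-anomalous — corner A2
(a_p ≡ 1 mod p) is exactly its excluded case; BST arXiv:2409.01350 Thm 1.9 needs (irr_ℚ); Disegni
arXiv:2001.00045 §1.7 defers critical slope to BPS.
Nearest prior art found: BuyukbodukPollackSasaki2018 = arXiv:1811.08216 Thm. 1.1.6 / Cor. 1.1.2
(p-part of the BSD formula in analytic rank one if h_α or h_β is non-degenerate; supersin  [refs: 1811.08216, 2409.01350, 1012.0175, 2008.02571, 2303.04373, 2001.00045, BuyukbodukPollackSasaki2018]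

Barriers (technique_class: critical-slope-padic-L, p-adic-heights, cyclotomic-iwasawa): - technique_class: critical-slope-padic-L, p-adic-heights, cyclotomic-iwasawa
- Literature.Barriers.BirchSwinnertonDyer.PAdicHeightBarrier: INSIDE its technique class for the
unit-root height `h_α` and it does NOT beat it head-on — the crux ASSUMES `h_α` degenerate on its
locus (so by the barrier's own equivalence `ord_T L_p(f,α,T) ≥ 2 > 1 = r_an` there and the α-road is
dead) and exits through the slope-one height `h_β`, i.e. exactly the barrier file's recorded evasion
(ii) of `PAdicHeightBarrierNarrow` («ordinary p, analytic rank one, E non-CM with ρ̄ absolutely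
irreducible: h_α or h_β non-degenerate» [BuyukbodukPollackSasaki2018, Thm. 1.1.6 / Cor. 1.1.2]) and
its unconditional conjunct (2) `padicHeightBarrierNarrow_gap` /
`ne_zero_or_ne_zero_of_sub_eq_mul_sq` (`h_α − h_β = c·log_ω²`, `c ≠ 0`; kit j244598/j245214: `c =
(α−β)/F₂₁`, `v_p(c) = −v_p(F₂₁) ∈ [−7,−2]` on all 2 797 A2 pairs); the bet is that evasion (ii)
survives dropping «ρ̄ absolutely irreducible» (corner A2 has `E[p]` reducible) — scope caveat (e) of
the Narrow entry (θ-criticality automatic off CM; disjunction not equality) is honoured because the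
crux only needs `h_β(P,P) ≠ 0` on the locus where `h_α(P,P) = 0`.
- Literature.Barriers.BirchSwinnertonDyer.PAdicHeightBarrierNarrow: same placement, stated against
the audited entry: conjunct (1) (slope-zero `L_p(f,α,T)` + canonical height) is what the crux
concedes; conjunct (2) is the lever; nothing here claims `ord_T L_p(f,α,T) = 1` on the degenerate
locus.
- I1 n

sub-problem: BirchSwinnertonDyer · status: draft · opened planner-bsd-schneider-ideate-P3-g6-0 2026-08-25T21:11:34Z · rev 1 · ledger route-BirchSwinnertonDyer-SlopeDichotomyA2
GENERATED by the gate from the ledger (D-0016/17). Provers cite these decls: `theorem foo : Summit.BirchSwinnertonDyer.BirchSwinnertonDyer.Theses.SlopeDichotomyA2.<Decl> := …` in Summits/BirchSwinnertonDyer/BirchSwinnertonDyer/Theorems/<Name>.lean.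
-/

namespace Summit.BirchSwinnertonDyer.BirchSwinnertonDyer.Theses.SlopeDichotomyA2

open scoped BigOperators Topology Manifold Classical MeasureTheory ProbabilityTheory Matrix InnerProductSpace ComplexConjugate ContinuousMap
open Filter Set Function TopologicalSpace MeasureTheory

attribute [summit_statement] _root_.BirchSwinnertonDyer
attribute [summit_statement] _root_.Summit.BirchSwinnertonDyer.BirchSwinnertonDyer.Theorems.SchneiderWeaken.TypeBRankOneUnridered

open Literature

/-- item stmt-BirchSwinnertonDyer-19086 · crux · rank 2 · open · by planner
why it might fail: the β-road's p-adic Gross–Zagier (BPS Cor. 1.1.2) is proved only for absolutely irreducible ρ̄ and rests on Kobayashi's unpublished critical-slope GZ; at reducible anomalous p the integral β-main conjecture for the GV lattice may be false (μ/λ shift along the p-isogeny).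
sources: BuyukbodukPollackSasaki2018, arXiv:1811.08216, PerrinRiou1993AIF, arXiv:1012.0175, arXiv:2409.01350, GreenbergVatsal2000
[crux] the `p`-part of BSD on the degenerate locus of corner A2 — for every globally minimal `E/ℚ`,
odd prime `p` with `X1.TypeBRankOne W p` (good ordinary anomalous, `E[p]` reducible with GV parity,
`r_an = 1`) and a canonical `p`-adic height datum violating Schneider's conjecture, `BSDp W p`. It
is the leaf MINUS the α-road: modulo `PublishedInputsA2` it is EQUIVALENT to the leaf
(`SchneiderWeaken.leaf_iff_degenerateLocus_of_inputs`, proved in the landed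
`Theorems/SchneiderWeakenLeaf.lean`, p406724) — declared, not hidden: this is a conditional bridge /
redirect whose open half is this decl and whose closed half is the kernel theorem by name.
[difficulty: open-problem] -/
@[route_item "route-BirchSwinnertonDyer-SlopeDichotomyA2", crux]
def DegenerateLocusA2 : Prop :=
  ∀ (W : WeierstrassCurve ℚ) [W.IsElliptic] [W.IsGloballyMinimal] (p : ℕ) [Fact p.Prime], Summit.BirchSwinnertonDyer.Rank1Residual.X1.TypeBRankOne W p → (∃ Dh : WeierstrassCurve.PAdicHeightData W p, Dh.IsCanonical ∧ ¬ WeierstrassCurve.SchneiderConjecture Dh) → Literature.NumberTheory.EllipticCurves.BSDp W p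

-- item stmt-BirchSwinnertonDyer-19171 · support · rank 3 · open · by planner — informal only, no Lean statement yet:
--   [crux] β-road p-adic Gross–Zagier at critical slope for A2 pairs (Heegner/BDP classes in a Coleman
--   family through the critical-slope refinement f_β at an EISENSTEIN anomalous point): the cyclotomic
--   derivative L′_{p,β} at s=1 equals (unit)·h_β(Heegner point) for the critical-slope canonical height
--   h_β; why it might fail: Büyükboduk–Pollack–Sasaki arXiv:1811.08216 Thm 1.1.6 / Cor 1.1.2 require
--   ρ̄_{E,p} absolutely irreducible (p.4) and rest on Kobayashi (critical-slope GZ, in progress, p.17);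
--   the anticyclotomic (BDP/Heegner-point main conjecture) road that gives the p-part of BSD in rank ≤ 1
--   at E

-- item stmt-BirchSwinnertonDyer-19172 · support · rank 4 · open · by planner — informal only, no Lean statement yet:
--   [crux] Perrin-Riou D_[0]-direction (critical-slope) leading-term formula for L_p(f,β,T) at T=0 in
--   rank one with the Greenberg–Vatsal lattice, INTEGRALLY at an anomalous reducible prime p:
--   L′_{p,β}(0) ≐ (1−1/β)^2 · h_β(P,P) · #Ш · ∏ c_ℓ / #E(ℚ)_tors^2 up to a p-adic unit, with h_β the
--   splitting-by-β canonical height; why it might fail: C_p(V)-integrality of Perrin-Riou’s regulator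
--   map and the μ/λ shift along the p-isogeny at a reducible prime (the GV lattice is not the optimal
--   one), and at p=3 the exponential has extra denominators; sources: PerrinRiou1993AIF Prop 3.4.6,
--   PerrinRiou1993AIF 3.3.7

-- item stmt-BirchSwinnertonDyer-19173 · support · rank 5 · open · by planner — informal only, no Lean statement yet:
--   [crux → support once D2/D3 land] slope-gap identity: for every good ordinary pair (E,p) with unit
--   root α ≠ β = p/α, the two splitting heights differ by a rank-one form, h_α − h_β = c · log_ω ⊗ log_ω
--   with an explicit constant c = c(E,p) ≠ 0 ([α:β]-dependence of the Frobenius splitting of D_cris);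
--   consequence used by the route: if h_α(P,P)=0 for a non-torsion P then h_β(P,P) = −c·log_ω(P)^2 ≠ 0,
--   so on the degenerate locus the β-height is automatically non-degenerate; kit census j244598 (2 797
--   A2 class-pairs, N < 5·10^5): B = −log_ω(P)^2 exactly, v_p(c) ∈ [−7,−2], h_α ≠ 0 ∧ h_β ≠ 0 on 2 797/2
--   797

-- item stmt-BirchSwinnertonDyer-19174 · support · rank 6 · open · by planner — informal only, no Lean statement yet:
--   [crux] critical-slope (β) Iwasawa main conjecture on corner A2: for a type-B rank-one pair (E,p)
--   (good ordinary anomalous, E[p] reducible with Greenberg–Vatsal parity) and the Greenberg–Vatsal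
--   lattice, the characteristic ideal of the relevant (fine / β-) Selmer structure over the cyclotomic
--   ℤ_p-extension is generated by the critical-slope L-function in the Lei–Loeffler–Zerbes sense
--   (β·L_{p,β} = L_{p,1}·𝔐⁻¹((1+π)φ(t/π)) − L_{p,2}·𝔐⁻¹((1+π)φ(a)), L_{p,1}, L_{p,2} ∈ Λ; the α-main
--   conjecture controls L_{p,2} = α·L_{p,α} only), at least as the divisibility that makes Perrin-Riou’s
--   𝔏_PR a generator

/-- item stmt-BirchSwinnertonDyer-19087 · support · rank 9 · open · by planner
sources: GreenbergVatsal2000, Schneider1985, BalakrishnanMullerStein2015, PerrinRiou1987, MazurSteinTate2006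
[support] the six PUBLISHED inputs of the kernel's A2 theorem as one closed conjunction of named
Literature facts (each `def … : Prop`, cite-tagged, unproved in the tree, used BY NAME):
Greenberg–Vatsal 2000 Thm. (1.3) for the GV-parity lattice at odd `p`; Schneider 1985 /
Balakrishnan–Müller–Stein 2015 Thm. 1.7 (order and leading coefficient of the characteristic series,
odd `p`); Perrin-Riou 1987 §1.4 (rank-one leading terms, odd `p`); Mazur–Stein–Tate 2006 Thm. 1.3 (a
Mazur–Tate σ / canonical datum exists at odd `p`); modularity (a modular parametrisation exists);
Gross–Zagier–Kolyvagin (rank = analytic rank ≤ 1). A prover closes it only by landing the facts; the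
route needs it as the hypothesis list of the α-road. [difficulty: open-problem] -/
@[route_item "route-BirchSwinnertonDyer-SlopeDichotomyA2", crux]
def PublishedInputsA2 : Prop :=
  Literature.NumberTheory.EllipticCurves.GreenbergVatsal2000.thm13_charIdeal_eq_of_gvPar ∧ Literature.NumberTheory.EllipticCurves.Schneider1985_order_charGenerator_odd ∧ Literature.NumberTheory.EllipticCurves.perrinRiou_rankOne_leadingTerms_odd ∧ Literature.NumberTheory.EllipticCurves.mazur_tate_sigma_exists_odd ∧ Literature.NumberTheory.EllipticCurves.ModularForms.nonempty_modularParametrizationData ∧ Literature.NumberTheory.EllipticCurves.rank_eq_analyticRank_of_analyticRank_le_one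

/-- item stmt-BirchSwinnertonDyer-19088 · assembly · rank 1 · closed · proved by Summit.BirchSwinnertonDyer.BirchSwinnertonDyer.Theorems.slopeDichotomyA2_assembly_proof (prover) · by planner
sources: GreenbergVatsal2000, BuyukbodukPollackSasaki2018
[assembly] DegenerateLocusA2 → PublishedInputsA2 → the rung leaf TypeBRankOneUnridered (BSD_p on
every A2 pair, rider deleted) -/
@[route_item "route-BirchSwinnertonDyer-SlopeDichotomyA2"]
def Assembly : Prop :=
  DegenerateLocusA2 → PublishedInputsA2 → Summit.BirchSwinnertonDyer.BirchSwinnertonDyer.Theorems.SchneiderWeaken.TypeBRankOneUnridered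

-- `Assembly` holds: proved by `Summit.BirchSwinnertonDyer.BirchSwinnertonDyer.Theorems.slopeDichotomyA2_assembly_proof` (its module imports this route file, so no `_holds` link can be stated here).

/-! D-0027 §2.1 — DECIDING THEOREM (planner-authored via `route open/edit --closes-file`; by planner-bsd-schneider-ideate-P3-g6-0 2026-08-25T21:11:34Z):
its hypotheses are this route's items and its conclusion the registered leaf `Summit.BirchSwinnertonDyer.BirchSwinnertonDyer.Theorems.SchneiderWeaken.TypeBRankOneUnridered` (rung I1, D-0061) (glue_lint), and it elaborates with this file. -/

@[closes "route-BirchSwinnertonDyer-SlopeDichotomyA2"] theorem closes (h2 : DegenerateLocusA2) (hF : PublishedInputsA2) :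
    Summit.BirchSwinnertonDyer.BirchSwinnertonDyer.Theorems.SchneiderWeaken.TypeBRankOneUnridered := by
  intro W _ _ p _ hB
  by_cases hSch : ∀ Dh : WeierstrassCurve.PAdicHeightData W p,
      Dh.IsCanonical → WeierstrassCurve.SchneiderConjecture Dh
  · obtain ⟨hGV, hS, hPR, hMT, hmod, hGZK⟩ := hF
    exact Summit.BirchSwinnertonDyer.Rank1Residual.X1.bsdp_of_typeBRankOne_of_schneider
      hGV hS hPR hMT hmod hGZK W p hB hSch
  · push Not at hSch
    obtain ⟨Dh, hDh, hnot⟩ := hSch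
    exact h2 W p hB ⟨Dh, hDh, hnot⟩

end Summit.BirchSwinnertonDyer.BirchSwinnertonDyer.Theses.SlopeDichotomyA2
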